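import Literature.MathematicalPhysics.QuantumFieldTheory.Balaban1983to89.HaarDensitySymplecticGlobal
import Mathlib.MeasureTheory.Integral.Marginal

/-!
# `Balaban1983to89.HaarExponentialChartProduct` — [Balaban1985UV3] (18) p. 260: THE CHANGE OF VARIABLES `U′(b) = exp A′(b)`
# ON ALL BOND VARIABLES AT ONCE — the product Haar measure `Π_b dU′(b)` in exponential coordinates is
# `σ₀^{|B|} · Π_b (σ/σ₀)(A′(b)) dA′(b)` on `Ω^B` (print's factor `exp(|Ω₁| log σ₀)` in (18))

statement-level skeleton of published theorems with citation tags; proofs where landed; nothing here is a claim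
about the Yang–Mills mass gap

Mega-formalization `lit-balaban` (HOME `run/shared/lean/pub/lit-balaban/`), unit `lit-balaban-p28` gen 16 (Phase-2
proof seat; free-target protocol G.5-34(d), TAKING 2026-08-23T11:03Z).  File 8 (rider).  Gens 10/13 and this
generation's files 4–5 give [Helgason2000] (13) ∕ [Balaban1985UV3] p. 260 «dU′ = σ(A′)dA′ = σ₀ (σ/σ₀)(A′)dA′» for ONE
group variable.  Print uses it in (18) for the whole family of bond variables `{U′(b)}_{b ∈ B}` of the block
`Ω₁` — the measure there is the PRODUCT Haar measure and the normalisation appears as `exp(… + log σ₀ |Ω₁|)`, i.e.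
`σ₀^{|B|}`.  THIS FILE proves that product form, by Fubini–Tonelli on the finite product: for every compact group
`G` with an exponential chart `Θ` injective on a Borel `Ω ⊆ 𝔤` of full measure (gen 13's hypotheses) and every
finite bond set `B`,
`⊗_{b∈B} μ = σ₀^{|B|} · (Θ^B)_*(Π_b |det jac(A_b)| · (⊗_b η)|_{Ω^B})`,
`∫_{G^B} F d(⊗μ) = σ₀^{|B|} ∫_{Ω^B} F((e^{A_b})_b) Π_b |det jac(A_b)| d(⊗η)`, `σ₀ = μ(G)/∫_Ω |det jac| dη`,
and instantiates it hypothesis-free for `U(N)` (gen 13), `SO(N)` (file 4) and `Sp(n)` (file 5) on the maximal ball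
`Ω = {‖A‖ < π}`.  SKELETON rows served (SUPPORT cells only, no head change): B10.Eq21 / display E18 ([Balaban1985UV3]
(18)/(21) pp. 260–261, owner r07), B13.Eq1.37 (r10), B12.Eq2.10–2.12 (r09/r20).

CITATION HEADER.  [Balaban1985UV3] T. Bałaban, CMP **102** (1985) 255–275 (held `paper:balaban1985-cmp102-uv-
stability-3d`), p. 260 (PDF p. 6): *«To write the integrals (13) in terms of the variables A we express the Haar
measure dU′ as dU′ = σ(A′)dA′ = σ₀ σ/σ₀ (A′)dA′, σ₀ = σ(0), where dA is the Lebesgue measure on g … Thus we have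
[(18)] … Π_{b′∈Ω₁} … dA … exp[− … + log σ₀ |Ω₁|]»* — the product over the bond variables with the factor `σ₀^{|Ω₁|}`.
[Helgason2000] Ch. I §1 Thm. 1.14 (13) p. 96 (one variable; gen 13's `IsChartRep.lintegral_haar_eq_of_null`).

WHAT IS PROVED (theorems only; 0 definitions, 0 named facts, 0 sorry; axioms standard).
* §1 (private, [folklore] Fubini–Tonelli on finite products) `lintegral_prod_pi` (`∫ Π_i f_i(x_i) d(⊗κ) = Π_i ∫ f_i dκ_i`),
  `pi_withDensity` (`⊗_i (f_i · κ_i) = (Π_i f_i(x_i)) · ⊗κ`), `pi_const_smul` (`⊗_i (c_i κ_i) = (Π c_i) ⊗κ`).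
* §2 for a general `IsChartRep` (gen 10/13 setting) and a finite `B`: **`IsChartRep.pi_haar_eq_smul_of_null`** (the
  measure identity above) and **`IsChartRep.lintegral_pi_haar_eq_of_null`** (the integral form, every measurable `F ≥ 0`
  on `G^B`).
* §3 hypothesis-free instances on `Ω = {‖A‖ < π}`: **`lintegral_pi_haar_unitaryGroup_eq`** (`U(N)`),
  **`lintegral_pi_haar_specialOrthogonal_eq`** (`SO(N)`), **`lintegral_pi_haar_symplectic_eq`** (`Sp(n)`).

HONEST SCOPE.  (i) The density is kept as gen 10's `jacDensity = |det((1 − e^{−adA})/adA)|`; the explicit `sinc`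
products are the one-variable rewriting lemmas of gens 11–12 (`jacDensity_*_eq_of_diag`), applied factorwise by the
consumer.  (ii) `SU(N)` (gen 14: alcove/Weyl-chamber domain, not the ball) is not instantiated here.  (iii) `σ₀`
identified, not evaluated.  (iv) Nothing of gens 10–14 or files 1–7 is re-proved.  Failed printed steps: none
(HOME/GAPS.md unchanged).
-/

noncomputable section

open NormedSpace Set Function Filter Topology MeasureTheory
open scoped ENNReal NNReal Matrix.Norms.L2Operator

namespace Literature.MathematicalPhysics.QuantumFieldTheory.Balaban1983to89

/-! ## §1 Fubini–Tonelli on finite products (private helpers) -/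

namespace HaarExponentialChartProduct

variable {ι : Type*} [Fintype ι] {E : Type*} [MeasurableSpace E]

omit [Fintype ι] in
/-- `∫ c · Π_{i∈s} f_i(x_i)`, marginalised over `s`, is the constant `c · Π_{i∈s} ∫ f_i dκ_i`. [folklore] -/
private theorem lmarginal_const_mul_prod (κ : ι → Measure E) [∀ i, SigmaFinite (κ i)] {f : ι → E → ℝ≥0∞}
    (hf : ∀ i, Measurable (f i)) [DecidableEq ι] (s : Finset ι) :
    ∀ (c : ℝ≥0∞) (x : ι → E),
      (∫⋯∫⁻_s, (fun y => c * ∏ i ∈ s, f i (y i)) ∂κ) x = c * ∏ i ∈ s, ∫⁻ y, f i y ∂(κ i) := by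
  induction s using Finset.induction_on with
  | empty =>
    intro c x
    simp only [lmarginal_empty, Finset.prod_empty, mul_one]
  | @insert i s hi ih =>
    intro c x
    have hmeas : Measurable fun y : ι → E => c * ∏ j ∈ insert i s, f j (y j) :=
      measurable_const.mul (Finset.measurable_prod _ fun j _ => (hf j).comp (measurable_pi_apply j))
    rw [lmarginal_insert' _ hmeas hi]
    have hfun : (fun y : ι → E => ∫⁻ t, (fun z : ι → E => c * ∏ j ∈ insert i s, f j (z j)) (Function.update y i t) ∂κ i)
        = fun y => (c * ∫⁻ t, f i t ∂κ i) * ∏ j ∈ s, f j (y j) := by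
      funext y
      have hpt : ∀ t, c * ∏ j ∈ insert i s, f j (Function.update y i t j) = (c * ∏ j ∈ s, f j (y j)) * f i t := by
        intro t
        rw [Finset.prod_insert hi, Function.update_self,
          Finset.prod_congr rfl (fun j hj => by rw [Function.update_of_ne (ne_of_mem_of_not_mem hj hi)])]
        ring
      simp only [hpt]
      rw [lintegral_const_mul _ (hf i)]
      ring
    rw [hfun, ih, Finset.prod_insert hi]
    ring

/-- **Tonelli on a finite product: `∫ Π_i f_i(x_i) d(⊗_i κ_i) = Π_i ∫ f_i dκ_i`** for measurable `f_i ≥ 0` and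
σ-finite `κ_i`. [folklore] -/
private theorem lintegral_prod_pi (κ : ι → Measure E) [∀ i, SigmaFinite (κ i)] {f : ι → E → ℝ≥0∞}
    (hf : ∀ i, Measurable (f i)) (x₀ : ι → E) :
    ∫⁻ x, ∏ i, f i (x i) ∂(Measure.pi κ) = ∏ i, ∫⁻ y, f i y ∂(κ i) := by
  classical
  rw [lintegral_eq_lmarginal_univ x₀]
  have h := lmarginal_const_mul_prod κ hf Finset.univ 1 x₀
  simp only [one_mul] at h
  exact h

/-- **`⊗_i (f_i · κ_i) = (Π_i f_i(x_i)) · ⊗_i κ_i`** (product of measures with densities). [folklore] -/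
private theorem pi_withDensity (κ : ι → Measure E) [∀ i, SigmaFinite (κ i)] {f : ι → E → ℝ≥0∞}
    (hf : ∀ i, Measurable (f i)) [∀ i, SigmaFinite ((κ i).withDensity (f i))] (x₀ : ι → E) :
    Measure.pi (fun i => (κ i).withDensity (f i)) = (Measure.pi κ).withDensity (fun x => ∏ i, f i (x i)) := by
  refine Measure.pi_eq (μ := fun i => (κ i).withDensity (f i)) fun s hs => ?_
  rw [withDensity_apply _ (MeasurableSet.univ_pi hs), ← lintegral_indicator (MeasurableSet.univ_pi hs)]
  have hind : (Set.pi univ s).indicator (fun x : ι → E => ∏ i, f i (x i)) =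
      fun x => ∏ i, (s i).indicator (f i) (x i) := by
    funext x
    by_cases hx : x ∈ Set.pi univ s
    · rw [indicator_of_mem hx]
      exact Finset.prod_congr rfl fun i _ => (indicator_of_mem (hx i (mem_univ i)) _).symm
    · rw [indicator_of_notMem hx]
      simp only [Set.mem_univ_pi, not_forall] at hx
      obtain ⟨i, hi⟩ := hx
      exact (Finset.prod_eq_zero (Finset.mem_univ i) (indicator_of_notMem hi _)).symm
  rw [hind, lintegral_prod_pi κ (fun i => (hf i).indicator (hs i)) x₀]
  exact Finset.prod_congr rfl fun i _ => by rw [withDensity_apply _ (hs i), lintegral_indicator (hs i)]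

/-- **`⊗_i (c_i • κ_i) = (Π_i c_i) • ⊗_i κ_i`**. [folklore] -/
private theorem pi_const_smul (κ : ι → Measure E) [∀ i, SigmaFinite (κ i)] (c : ι → ℝ≥0∞)
    [∀ i, SigmaFinite (c i • κ i)] :
    Measure.pi (fun i => c i • κ i) = (∏ i, c i) • Measure.pi κ := by
  refine Measure.pi_eq (μ := fun i => c i • κ i) fun s _ => ?_
  rw [Measure.smul_apply, smul_eq_mul, Measure.pi_pi, ← Finset.prod_mul_distrib]
  exact Finset.prod_congr rfl fun i _ => by rw [Measure.smul_apply, smul_eq_mul]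

end HaarExponentialChartProduct

/-! ## §2 The product Haar measure in exponential coordinates (general `IsChartRep`) -/

namespace HaarExponentialChart

namespace IsChartRep

open HaarExponentialChartProduct

variable {𝔸 : Type*} [NormedRing 𝔸] [NormedAlgebra ℂ 𝔸] [CompleteSpace 𝔸]
variable {G : Type*} [Group G] [TopologicalSpace G] [IsTopologicalGroup G] [CompactSpace G]
variable {C : LogChart 𝔸} {ρ : G →* 𝔸} (h : IsChartRep C ρ) [FiniteDimensional ℝ C.lie]
  (hlie : ∀ x ∈ C.lie, ∀ y ∈ C.lie, x * y - y * x ∈ C.lie)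
variable [MeasurableSpace C.lie] [BorelSpace C.lie] (η : Measure C.lie) [η.IsAddHaarMeasure]
variable [MeasurableSpace G] [BorelSpace G] (μ : Measure G) [μ.IsHaarMeasure]
variable (B : Type*) [Fintype B]

/-- **[Balaban1985UV3] (18): THE PRODUCT HAAR MEASURE OVER A FINITE BOND SET `B` IN EXPONENTIAL COORDINATES —
`⊗_{b∈B} μ = σ₀^{|B|} · (Θ^B)_*(Π_b |det jac(A_b)| · (⊗_b η)|_{Ω^B})`, `σ₀ = μ(G)/∫_Ω |det jac| dη`**, whenever `Θ`
is injective on the Borel set `Ω` and `μ((Θ Ω)ᶜ) = 0` (gen 13's one-variable identity `μ = σ₀ • Θ_*(|det jac| dη|_Ω)`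
tensored `|B|` times: Fubini–Tonelli). [cite: Balaban1985UV3, (18) p. 260] [cite: Helgason2000, Ch. I §1 Thm. 1.14 (13) p. 96] -/
theorem pi_haar_eq_smul_of_null {s : ℝ} (hs0 : 0 < s) (hs : s ≤ chartRadius C) {Ω : Set C.lie}
    (hΩ : MeasurableSet Ω) (hinj : Set.InjOn h.expChart Ω) (hnull : μ (h.expChart '' Ω)ᶜ = 0) :
    Measure.pi (fun _ : B => μ) =
      (μ Set.univ / ∫⁻ X in Ω, jacDensity hlie X ∂η) ^ Fintype.card B •
        (((Measure.pi fun _ : B => η).restrict (Set.pi Set.univ fun _ => Ω)).withDensity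
            (fun A => ∏ b, jacDensity hlie (A b))).map (fun A b => h.expChart (A b)) := by
  classical
  obtain ⟨huniv, hI0, hItop⟩ := h.haar_univ_eq_of_null hlie η μ hs0 hs hΩ hinj hnull
  set c : ℝ≥0∞ := μ (h.window s) / h.chartMeasure hlie η s (h.window s) with hc
  have hcc : μ Set.univ / ∫⁻ X in Ω, jacDensity hlie X ∂η = c := by
    rw [huniv, ENNReal.mul_div_cancel_right hI0 hItop]
  have hcne : c ≠ ∞ := (h.windowConst_ne_zero_and_ne_top hlie η μ hs0 hs).2
  set κ : Measure C.lie := (η.restrict Ω).withDensity (jacDensity hlie) with hκ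
  haveI hκσ : SigmaFinite κ :=
    SigmaFinite.withDensity_of_ne_top' fun X => by rw [jacDensity_def]; exact ENNReal.ofReal_ne_top
  have hν : h.chartMeasureOn hlie η Ω = κ.map h.expChart := rfl
  haveI hfin : IsFiniteMeasure (κ.map h.expChart) :=
    ⟨by rw [← hν, h.chartMeasureOn_univ hlie η Ω]; exact hItop.lt_top⟩
  haveI hfin' : IsFiniteMeasure (c • κ.map h.expChart) :=
    ⟨by rw [Measure.smul_apply, smul_eq_mul]; exact ENNReal.mul_lt_top hcne.lt_top (measure_lt_top _ _)⟩
  have hμ : μ = c • κ.map h.expChart := h.haar_eq_smul_chartMeasureOn_of_null hlie η μ hs0 hs hΩ hinj hnull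
  -- step 1: constants out
  have h1 : Measure.pi (fun _ : B => μ) = c ^ Fintype.card B • Measure.pi (fun _ : B => κ.map h.expChart) := by
    have hfam : (fun _ : B => μ) = fun _ : B => c • κ.map h.expChart := funext fun _ => hμ
    rw [hfam, pi_const_smul (fun _ : B => κ.map h.expChart) (fun _ => c), Finset.prod_const, Finset.card_univ]
  -- step 2: push-forwards out
  have h2 : Measure.pi (fun _ : B => κ.map h.expChart) =
      (Measure.pi fun _ : B => κ).map (fun A b => h.expChart (A b)) :=
    (Measure.pi_map_pi fun _ => h.measurable_expChart.aemeasurable).symm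
  -- step 3: densities and restrictions out
  have h3 : Measure.pi (fun _ : B => κ) =
      ((Measure.pi fun _ : B => η).restrict (Set.pi Set.univ fun _ => Ω)).withDensity
        (fun A => ∏ b, jacDensity hlie (A b)) := by
    rw [hκ, pi_withDensity (fun _ : B => η.restrict Ω) (fun _ => measurable_jacDensity hlie) (fun _ => (0 : C.lie)),
      Measure.restrict_pi_pi]
  rw [h1, h2, h3, hcc]

/-- **[Balaban1985UV3] (18), INTEGRAL FORM: `∫_{G^B} F d(⊗_b μ) = σ₀^{|B|} ∫_{Ω^B} F((Θ A_b)_b) Π_b |det jac(A_b)| d(⊗_b η)`**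
for every measurable `F ≥ 0` on `G^B`, `σ₀ = μ(G)/∫_Ω |det jac| dη` — print's `Π_b dU′(b) = e^{|Ω₁| log σ₀} Π_b
(σ/σ₀)(A′(b)) dA′(b)`. [cite: Balaban1985UV3, (18) p. 260] [cite: Helgason2000, Ch. I §1 Thm. 1.14 (13) p. 96] -/
theorem lintegral_pi_haar_eq_of_null {s : ℝ} (hs0 : 0 < s) (hs : s ≤ chartRadius C) {Ω : Set C.lie}
    (hΩ : MeasurableSet Ω) (hinj : Set.InjOn h.expChart Ω) (hnull : μ (h.expChart '' Ω)ᶜ = 0)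
    {F : (B → G) → ℝ≥0∞} (hF : Measurable F) :
    ∫⁻ U, F U ∂(Measure.pi fun _ : B => μ) =
      (μ Set.univ / ∫⁻ X in Ω, jacDensity hlie X ∂η) ^ Fintype.card B *
        ∫⁻ A in Set.pi Set.univ (fun _ => Ω), F (fun b => h.expChart (A b)) * ∏ b, jacDensity hlie (A b)
          ∂(Measure.pi fun _ : B => η) := by
  have hΘ : Measurable fun (A : B → C.lie) (b : B) => h.expChart (A b) :=
    measurable_pi_lambda _ fun b => h.measurable_expChart.comp (measurable_pi_apply b)
  have hρ : Measurable fun A : B → C.lie => ∏ b, jacDensity hlie (A b) :=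
    Finset.measurable_prod _ fun b _ => (measurable_jacDensity hlie).comp (measurable_pi_apply b)
  have hFΘ : Measurable fun A : B → C.lie => F (fun b => h.expChart (A b)) := hF.comp hΘ
  rw [h.pi_haar_eq_smul_of_null hlie η μ B hs0 hs hΩ hinj hnull, lintegral_smul_measure, smul_eq_mul,
    lintegral_map hF hΘ, lintegral_withDensity_eq_lintegral_mul _ hρ hFΘ]
  congr 1
  refine lintegral_congr fun A => ?_
  simp only [Pi.mul_apply]
  rw [mul_comm]

end IsChartRep

end HaarExponentialChart

/-! ## §3 Hypothesis-free instances on the maximal ball: `U(N)`, `SO(N)`, `Sp(n)` -/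

namespace HaarExponentialChartProduct

open HaarExponentialChart HaarExponentialChart.IsChartRep
open LogChartClosedSubgroup (unitarySubgroupLogChart)
open HaarDensityOrthogonalChart (specialOrthogonalSubgroup isClosed_specialOrthogonalSubgroup)
open HaarDensitySymplecticChart (symplecticSubgroup isClosed_symplecticSubgroup)
open HaarSmallBallClosedSubgroup (compactSpace_of_isClosed_subgroup)

variable {n : Type*} [Fintype n] [DecidableEq n] (B : Type*) [Fintype B]

section Unitary

variable [MeasurableSpace (unitaryLogChart n).lie] [BorelSpace (unitaryLogChart n).lie]
  (η : Measure (unitaryLogChart n).lie) [η.IsAddHaarMeasure]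
  (μ : Measure (Matrix.unitaryGroup n ℂ)) [μ.IsHaarMeasure]

/-- **[Balaban1985UV3] (18) FOR `U(N)`-VALUED BOND VARIABLES: `∫_{U(N)^B} F d(⊗μ) = σ₀^{|B|} ∫_{‖A_b‖<π ∀b} F((e^{A_b})_b)
Π_b |det jac(A_b)| d(⊗η)`**, `σ₀ = μ(U(N))/∫_{‖A‖<π} |det jac| dη`, every measurable `F ≥ 0` (gen 13's full-measure
injectivity domain `{‖A‖ < π}`). [cite: Balaban1985UV3, (18) p. 260] [cite: Helgason2000, Ch. I §1 Thm. 1.14 (13) p. 96] -/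
theorem lintegral_pi_haar_unitaryGroup_eq {F : (B → Matrix.unitaryGroup n ℂ) → ℝ≥0∞} (hF : Measurable F) :
    ∫⁻ U, F U ∂(Measure.pi fun _ : B => μ) =
      (μ Set.univ / ∫⁻ X in Metric.ball 0 Real.pi, jacDensity (lie_adStable_unitaryGroup (n := n)) X ∂η) ^
          Fintype.card B *
        ∫⁻ A in Set.pi Set.univ (fun _ => Metric.ball 0 Real.pi),
          F (fun b => (isChartRep_unitaryGroup (n := n)).expChart (A b)) *
            ∏ b, jacDensity (lie_adStable_unitaryGroup (n := n)) (A b) ∂(Measure.pi fun _ : B => η) :=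
  (isChartRep_unitaryGroup (n := n)).lintegral_pi_haar_eq_of_null (lie_adStable_unitaryGroup (n := n)) η μ B
    IsChartRep.chartRadius_pos le_rfl measurableSet_ball HaarDensityUnitaryGlobal.injOn_expChart_ball_pi
    (HaarDensityUnitaryGlobal.haar_compl_image_ball_pi_eq_zero μ) hF

end Unitary

section Orthogonal

variable [MeasurableSpace (unitarySubgroupLogChart (specialOrthogonalSubgroup n) isClosed_specialOrthogonalSubgroup).lie]
  [BorelSpace (unitarySubgroupLogChart (specialOrthogonalSubgroup n) isClosed_specialOrthogonalSubgroup).lie]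
  (η : Measure (unitarySubgroupLogChart (specialOrthogonalSubgroup n) isClosed_specialOrthogonalSubgroup).lie)
  [η.IsAddHaarMeasure] (μ : Measure (specialOrthogonalSubgroup n)) [μ.IsHaarMeasure] [Nonempty n]

/-- **[Balaban1985UV3] (18) FOR `SO(N)`-VALUED BOND VARIABLES** (file 4's full-measure domain `{‖A‖ < π} ∩ 𝔬(N)`).
[cite: Balaban1985UV3, (18) p. 260] [cite: Helgason2000, Ch. I §1 Thm. 1.14 (13) p. 96] -/
theorem lintegral_pi_haar_specialOrthogonal_eq {F : (B → specialOrthogonalSubgroup n) → ℝ≥0∞} (hF : Measurable F) :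
    ∫⁻ U, F U ∂(Measure.pi fun _ : B => μ) =
      (μ Set.univ / ∫⁻ X in Metric.ball 0 Real.pi,
          jacDensity (lie_adStable_unitarySubgroup (specialOrthogonalSubgroup n) isClosed_specialOrthogonalSubgroup) X ∂η) ^
          Fintype.card B *
        ∫⁻ A in Set.pi Set.univ (fun _ => Metric.ball 0 Real.pi),
          F (fun b => (isChartRep_unitarySubgroup (specialOrthogonalSubgroup n) isClosed_specialOrthogonalSubgroup).expChart
            (A b)) *
            ∏ b, jacDensity (lie_adStable_unitarySubgroup (specialOrthogonalSubgroup n)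
              isClosed_specialOrthogonalSubgroup) (A b) ∂(Measure.pi fun _ : B => η) := by
  haveI : CompactSpace (specialOrthogonalSubgroup n) :=
    compactSpace_of_isClosed_subgroup _ isClosed_specialOrthogonalSubgroup
  exact (isChartRep_unitarySubgroup (specialOrthogonalSubgroup n) isClosed_specialOrthogonalSubgroup).lintegral_pi_haar_eq_of_null
    (lie_adStable_unitarySubgroup (specialOrthogonalSubgroup n) isClosed_specialOrthogonalSubgroup) η μ B
    IsChartRep.chartRadius_pos le_rfl measurableSet_ball (HaarDensityUnitaryGlobal.injOn_expChart_unitarySubgroup_ball_pi _ _)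
    (HaarDensityOrthogonalGlobal.haar_compl_image_ball_pi_eq_zero μ) hF

end Orthogonal

section Symplectic

variable {l : Type*} [Fintype l] [DecidableEq l]
variable [MeasurableSpace (unitarySubgroupLogChart (symplecticSubgroup (Matrix.J l ℂ)) isClosed_symplecticSubgroup).lie]
  [BorelSpace (unitarySubgroupLogChart (symplecticSubgroup (Matrix.J l ℂ)) isClosed_symplecticSubgroup).lie]
  (η : Measure (unitarySubgroupLogChart (symplecticSubgroup (Matrix.J l ℂ)) isClosed_symplecticSubgroup).lie)
  [η.IsAddHaarMeasure] (μ : Measure (symplecticSubgroup (Matrix.J l ℂ))) [μ.IsHaarMeasure]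

/-- **[Balaban1985UV3] (18) FOR `Sp(n)`-VALUED BOND VARIABLES** (file 5's full-measure domain `{‖A‖ < π} ∩ 𝔰𝔭(n)`).
[cite: Balaban1985UV3, (18) p. 260] [cite: Helgason2000, Ch. I §1 Thm. 1.14 (13) p. 96] -/
theorem lintegral_pi_haar_symplectic_eq {F : (B → symplecticSubgroup (Matrix.J l ℂ)) → ℝ≥0∞} (hF : Measurable F) :
    ∫⁻ U, F U ∂(Measure.pi fun _ : B => μ) =
      (μ Set.univ / ∫⁻ X in Metric.ball 0 Real.pi,
          jacDensity (lie_adStable_unitarySubgroup (symplecticSubgroup (Matrix.J l ℂ)) isClosed_symplecticSubgroup) X ∂η) ^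
          Fintype.card B *
        ∫⁻ A in Set.pi Set.univ (fun _ => Metric.ball 0 Real.pi),
          F (fun b => (isChartRep_unitarySubgroup (symplecticSubgroup (Matrix.J l ℂ)) isClosed_symplecticSubgroup).expChart
            (A b)) *
            ∏ b, jacDensity (lie_adStable_unitarySubgroup (symplecticSubgroup (Matrix.J l ℂ))
              isClosed_symplecticSubgroup) (A b) ∂(Measure.pi fun _ : B => η) := by
  haveI : CompactSpace (symplecticSubgroup (Matrix.J l ℂ)) :=
    compactSpace_of_isClosed_subgroup _ isClosed_symplecticSubgroup
  exact (isChartRep_unitarySubgroup (symplecticSubgroup (Matrix.J l ℂ)) isClosed_symplecticSubgroup).lintegral_pi_haar_eq_of_null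
    (lie_adStable_unitarySubgroup (symplecticSubgroup (Matrix.J l ℂ)) isClosed_symplecticSubgroup) η μ B
    IsChartRep.chartRadius_pos le_rfl measurableSet_ball (HaarDensityUnitaryGlobal.injOn_expChart_unitarySubgroup_ball_pi _ _)
    (HaarDensitySymplecticGlobal.haar_compl_image_ball_pi_eq_zero μ) hF

end Symplectic

end HaarExponentialChartProduct

end Literature.MathematicalPhysics.QuantumFieldTheory.Balaban1983to89

end
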